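import Summits.BirchSwinnertonDyer.BirchSwinnertonDyer.Theorems.PrintCFramBottomClassIndexLawFiveLeHerbrandOddClassGroupDescent
import Summits.BirchSwinnertonDyer.BirchSwinnertonDyer.Theorems.PrintCFramBottomClassIndexLawFiveLeHerbrandEigenspaceFunctionals
import HarnessLib

/-!
# Route `PrintCFram`, crux C2 `BottomClassIndexLawFiveLe` (stmt-BirchSwinnertonDyer-20372), line
# `eisenstein-resource-bdp-line` v10, Stub H, typing item T5: THE ODD CLASS-GROUP TERMS IN THE `𝔽_p`-EIGENSPACE CURRENCY —
# `X = 𝔽_p ⊗_ℤ Cl(K)`, `X^{(θ̄)} = ⨅_g eigenspace = ⊥`, hence every `θ̄`-equivariant `𝔽_p`-linear map out of `X` is `0` (F1ᵈ)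
# (cell `bsd-print-cfram`, seat `bsd-line-cfram-p1-w6` g0; helper `--supports` 20372; 0 facts, 0 defs)

HONEST FRAMING. Nothing about BSD is proved here; no summit statement is proved by this seat. The T2′ socket (w4 g5) ends in
`HerbrandEigenspace.eq_zero_of_equivariant_of_iInf_eigenspace_eq_bot`: a `θ̄`-equivariant `k`-linear map out of a `k[G]`-module `X` with
`X^{(θ̄)} = ⨅_g eigenspace (ρ g) (θ̄ g) = ⊥` vanishes. LEAD g8's blueprint (report g8 §4) asks T5 for the DUAL FORM "every
`b∘χ_m`-equivariant `Cl_F → 𝔽_p` is `0`" (F1ᵈ). This file supplies the `𝔽_p[G]`-module `X = 𝔽_p ⊗_ℤ Cl(K)` WITHOUT a new definition —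
it is the tree's `baseChangeRep (ZMod p) (classGroupRep ℚ K)` on `ZMod p ⊗[ℤ] Additive (ClassGroup (𝓞 K))` — and proves `X^{(θ̄)} = ⊥`
from the QUOTIENT form of the odd class-group terms (`…HerbrandOddClassGroupQuotient`), i.e. from Mazur–Wiles (either tree typing) and
`‖B_{1,χ⁻¹}‖_p = 1`; with w4 g5's lemma this gives F1ᵈ as a THEOREM (modulo the Mazur–Wiles fact): `linearMap_eq_zero_of_equivariant…`.
Generic algebra (any abelian group `M`): `1 ⊗ · : M → 𝔽_p ⊗_ℤ M` is onto (`exists_one_tmul_eq`) with kernel `pM`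
(`exists_eq_smul_of_one_tmul_zmod_eq_zero`, through `ℤ/(p) ≃ 𝔽_p` and Mathlib's `TensorProduct.quotTensorEquivQuotSMul`), so the
`θ̄`-eigenspace of `𝔽_p ⊗ M` is `⊥` as soon as every `θ̄`-eigenvector modulo `p` lies in `pM`
(`iInf_eigenspace_baseChangeRep_eq_bot_of_forall`).

THEOREMS ONLY; no definition, no named fact, no `sorry`; imports no `Theses` module. The Mazur–Wiles facts are HYPOTHESES.
References: [MazurWiles1984] Thm. 2 (p. 216) via [Solomon1990] p. 468; [Washington1997] §6.3 (χ-components over `𝔽_p`); [Lang1990] Ch. 1 §3.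
-/

set_option autoImplicit false
-- `…BirchSwinnertonDyer.BirchSwinnertonDyer.Theorems…` is the problem's mandated namespace (D-0017).
set_option linter.dupNamespace false

noncomputable section

open scoped TensorProduct
open NumberField Field Module Module.End
open Literature.RepresentationTheory.FiniteGroups Literature.NumberTheory.NumberFields
open Literature.NumberTheory.GaloisRepresentations Literature.NumberTheory.EllipticCurves

namespace Summit.BirchSwinnertonDyer.BirchSwinnertonDyer.Theorems.PrintCFram.HerbrandOddClassGroup

/-! ## §1 `𝔽_p ⊗_ℤ M = M/pM`: `1 ⊗ ·` is onto with kernel `pM` -/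

section ModP

variable {p : ℕ} [Fact p.Prime] {M : Type*} [AddCommGroup M]

/-- Every element of `𝔽_p ⊗_ℤ M` is `1 ⊗ x` (`a ⊗ m = 1 ⊗ (a.val • m)`). [folklore] -/
theorem exists_one_tmul_eq (ξ : ZMod p ⊗[ℤ] M) : ∃ x : M, ξ = (1 : ZMod p) ⊗ₜ[ℤ] x := by
  induction ξ using TensorProduct.induction_on with
  | zero => exact ⟨0, (TensorProduct.tmul_zero M (1 : ZMod p)).symm⟩
  | tmul a m =>
    refine ⟨(a.val : ℤ) • m, ?_⟩
    rw [← TensorProduct.smul_tmul]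
    congr 1
    rw [zsmul_eq_mul, mul_one, Int.cast_natCast, ZMod.natCast_zmod_val]
  | add x y hx hy =>
    obtain ⟨a, rfl⟩ := hx
    obtain ⟨b, rfl⟩ := hy
    exact ⟨a + b, (TensorProduct.tmul_add (1 : ZMod p) a b).symm⟩

/-- **`1 ⊗ z = 0` in `𝔽_p ⊗_ℤ M` ⟹ `z ∈ pM`** (any abelian group `M`): through the ring isomorphism `ℤ/(p) ≃ 𝔽_p` and
`(ℤ/(p)) ⊗_ℤ M ≃ M/pM` (Mathlib `TensorProduct.quotTensorEquivQuotSMul`). [folklore] -/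
theorem exists_eq_smul_of_one_tmul_zmod_eq_zero {z : M} (h : (1 : ZMod p) ⊗ₜ[ℤ] z = 0) :
    ∃ y : M, z = (p : ℤ) • y := by
  set I : Ideal ℤ := Ideal.span {((p : ℕ) : ℤ)} with hI
  -- the additive isomorphism `ℤ ⧸ I → 𝔽_p` as a `ℤ`-linear map, and its action on the left tensor factor
  let r : ℤ ⧸ I →+* ZMod p := (Int.quotientSpanNatEquivZMod p).toRingHom
  let f : ℤ ⧸ I →ₗ[ℤ] ZMod p := r.toAddMonoidHom.toIntLinearMap
  have hf1 : f 1 = 1 := by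
    change r 1 = 1
    exact map_one r
  have hfinj : Function.Injective f := (Int.quotientSpanNatEquivZMod p).injective
  -- `π : (ℤ ⧸ I) ⊗ M → 𝔽_p ⊗ M` is injective (`f` is an additive isomorphism, hence has a retraction)
  let finv : ZMod p →ₗ[ℤ] ℤ ⧸ I := (Int.quotientSpanNatEquivZMod p).symm.toRingHom.toAddMonoidHom.toIntLinearMap
  have hcomp : finv ∘ₗ f = LinearMap.id := by
    refine LinearMap.ext fun x => ?_
    change (Int.quotientSpanNatEquivZMod p).symm ((Int.quotientSpanNatEquivZMod p) x) = x
    exact (Int.quotientSpanNatEquivZMod p).symm_apply_apply x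
  have hπinj : Function.Injective (LinearMap.rTensor M f) := by
    intro a b hab
    have h2 := congrArg (LinearMap.rTensor M finv) hab
    rw [← LinearMap.comp_apply, ← LinearMap.comp_apply, ← LinearMap.rTensor_comp, hcomp,
      LinearMap.rTensor_id, LinearMap.id_apply, LinearMap.id_apply] at h2
    exact h2
  have hπ : LinearMap.rTensor M f ((1 : ℤ ⧸ I) ⊗ₜ[ℤ] z) = (1 : ZMod p) ⊗ₜ[ℤ] z := by
    rw [LinearMap.rTensor_tmul, hf1]
  have h0 : (1 : ℤ ⧸ I) ⊗ₜ[ℤ] z = 0 := hπinj (by rw [hπ, h, map_zero])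
  -- transport to `M ⧸ I • ⊤`
  have e0 : TensorProduct.quotTensorEquivQuotSMul M I ((1 : ℤ ⧸ I) ⊗ₜ[ℤ] z) = 0 := by
    have h0' := congrArg (TensorProduct.quotTensorEquivQuotSMul M I) h0
    exact h0'.trans (LinearEquiv.map_zero _)
  have hmk : (Submodule.Quotient.mk z : M ⧸ (I • (⊤ : Submodule ℤ M))) = 0 :=
    (TensorProduct.quotTensorEquivQuotSMul_mk_one_tmul (M := M) I z).symm.trans e0
  rw [Submodule.Quotient.mk_eq_zero, hI, Submodule.ideal_span_singleton_smul,
    Submodule.mem_smul_pointwise_iff_exists] at hmk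
  obtain ⟨y, -, hy⟩ := hmk
  exact ⟨y, hy.symm⟩

/-- `p` kills `𝔽_p ⊗_ℤ M`: `1 ⊗ (p • y) = 0`. [folklore] -/
theorem one_tmul_natCast_smul_eq_zero (y : M) : (1 : ZMod p) ⊗ₜ[ℤ] ((p : ℤ) • y) = 0 := by
  rw [← TensorProduct.smul_tmul, zsmul_eq_mul, mul_one, Int.cast_natCast, ZMod.natCast_self,
    TensorProduct.zero_tmul]

end ModP

/-! ## §2 `X^{(θ̄)} = ⊥` for `X = 𝔽_p ⊗_ℤ M` from the quotient form -/

section Eigenspace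

variable {p : ℕ} [Fact p.Prime] {G : Type*} [Group G] {M : Type*} [AddCommGroup M]

/-- **`(𝔽_p ⊗_ℤ M)^{(θ̄)} = ⊥` from the quotient form.** For a representation `ρ` of `G` on an abelian group `M` and a character
`θ̄ : G → 𝔽_pˣ`: if every `x ∈ M` with `ρ(g) x ≡ θ̄(g) x (mod pM)` for all `g` lies in `pM`, then the joint eigenspace
`⨅_g eigenspace ((ρ ⊗ 𝔽_p) g) (θ̄ g)` of `𝔽_p ⊗_ℤ M` (w4 g4's `χ`-part currency) is `⊥`. [cite: Washington1997, §6.3 (χ-components)] -/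
theorem iInf_eigenspace_baseChangeRep_eq_bot_of_forall (ρ : Representation ℤ G M) (θ : G →* (ZMod p)ˣ)
    (H : ∀ x : M, (∀ g : G, ∃ w : M, ρ g x = (((θ g : (ZMod p)ˣ) : ZMod p).val : ℤ) • x + (p : ℤ) • w) →
      ∃ y : M, x = (p : ℤ) • y) :
    (⨅ g : G, eigenspace (baseChangeRep (ZMod p) ρ g) ((θ g : (ZMod p)ˣ) : ZMod p)) = ⊥ := by
  rw [Submodule.eq_bot_iff]
  intro ξ hξ
  rw [Submodule.mem_iInf] at hξ
  obtain ⟨x, rfl⟩ := exists_one_tmul_eq ξ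
  have hx : ∀ g : G, ∃ w : M, ρ g x = (((θ g : (ZMod p)ˣ) : ZMod p).val : ℤ) • x + (p : ℤ) • w := by
    intro g
    have hg := mem_eigenspace_iff.mp (hξ g)
    rw [baseChangeRep_apply_tmul, TensorProduct.smul_tmul', smul_eq_mul, mul_one,
      ← ZMod.natCast_zmod_val ((θ g : (ZMod p)ˣ) : ZMod p), ← Int.cast_natCast,
      show (((((θ g : (ZMod p)ˣ) : ZMod p).val : ℕ) : ℤ) : ZMod p) =
        ((((θ g : (ZMod p)ˣ) : ZMod p).val : ℕ) : ℤ) • (1 : ZMod p) by rw [zsmul_eq_mul, mul_one],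
      TensorProduct.smul_tmul, ← sub_eq_zero, ← TensorProduct.tmul_sub] at hg
    obtain ⟨w, hw⟩ := exists_eq_smul_of_one_tmul_zmod_eq_zero hg
    exact ⟨w, by rw [← hw, add_sub_cancel]⟩
  obtain ⟨y, rfl⟩ := H x hx
  exact one_tmul_natCast_smul_eq_zero y

/-- Hence (w4 g5's `eq_zero_of_equivariant_of_iInf_eigenspace_eq_bot`): under the same hypothesis and `|G| ∈ 𝔽_pˣ`, every
`θ̄`-EQUIVARIANT `𝔽_p`-linear map `f : 𝔽_p ⊗_ℤ M → W` (`f((ρ ⊗ 𝔽_p)(g) ξ) = θ̄(g) f(ξ)`) is `0` — the DUAL FORM.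
[cite: Washington1997, §6.3 (χ-components)] -/
theorem linearMap_eq_zero_of_equivariant_of_forall [Fintype G] [Invertible (Fintype.card G : ZMod p)]
    (ρ : Representation ℤ G M) (θ : G →* (ZMod p)ˣ)
    (H : ∀ x : M, (∀ g : G, ∃ w : M, ρ g x = (((θ g : (ZMod p)ˣ) : ZMod p).val : ℤ) • x + (p : ℤ) • w) →
      ∃ y : M, x = (p : ℤ) • y)
    {W : Type*} [AddCommGroup W] [Module (ZMod p) W] (f : ZMod p ⊗[ℤ] M →ₗ[ZMod p] W)
    (hf : ∀ (g : G) (ξ : ZMod p ⊗[ℤ] M), f (baseChangeRep (ZMod p) ρ g ξ) = ((θ g : (ZMod p)ˣ) : ZMod p) • f ξ) :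
    f = 0 :=
  HerbrandEigenspace.eq_zero_of_equivariant_of_iInf_eigenspace_eq_bot (baseChangeRep (ZMod p) ρ) θ
    (iInf_eigenspace_baseChangeRep_eq_bot_of_forall ρ θ H) f hf

end Eigenspace

/-! ## §3 On `Cl(K)`: `(𝔽_p ⊗ Cl(K))^{(θ̄)} = ⊥` and F1ᵈ, under Mazur–Wiles -/

section ClassGroup

variable {p : ℕ} [Fact p.Prime] {K : Type} [Field K] [NumberField K] [IsAbelianGalois ℚ K]

/-- **`(𝔽_p ⊗_ℤ Cl(K))^{(θ̄)} = ⊥` for an odd `θ̄` with `p ∤ B_{1,χ⁻¹}`** (ASSUMING Mazur–Wiles, first tree typing): `p` odd, `K/ℚ`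
abelian with `p ∤ [K:ℚ]`, `χ` primitive odd non-Teichmüller with Galois avatar `ψ` (`ψ(τ̄) = χ(χ_f τ)`), `θ̄ = ψ mod p`,
`‖B_{1,χ⁻¹}‖_p = 1` ⟹ the joint `θ̄`-eigenspace of `baseChangeRep (ZMod p) (classGroupRep ℚ K)` is `⊥`.
[cite: MazurWiles1984, Thm. 2 (p. 216) — via Solomon1990, §I p. 468; Washington1997, §6.3] -/
theorem iInf_eigenspace_classGroup_modP_eq_bot
    (hMW : MazurWiles1984.thm2_card_oddChiClassGroup_eq_bernoulli) (hp2 : p ≠ 2)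
    (hpK : ¬ p ∣ Module.finrank ℚ K)
    {f : ℕ} [NeZero f] {χ : DirichletCharacter ℚ_[p] f} (hprim : χ.IsPrimitive) (hodd : χ.Odd)
    (hχω : ¬ ∀ a : ℤ, ¬ ((p : ℤ) ∣ a) → ‖χ (a : ZMod f) - (a : ℚ_[p])‖ < 1)
    {ψ : (K ≃ₐ[ℚ] K) →* ℤ_[p]ˣ}
    (hψχ : ∀ τ : absoluteGaloisGroup ℚ,
      (((ψ (absGaloisQuot ℚ K τ) : ℤ_[p]ˣ) : ℤ_[p]) : ℚ_[p]) =
        χ ((modNCyclotomicCharacter ℚ f τ : (ZMod f)ˣ) : ZMod f))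
    (hB : ‖KrizLi2019.bernoulliOnePrim χ⁻¹‖ = 1)
    (θ : (K ≃ₐ[ℚ] K) →* (ZMod p)ˣ)
    (hθ : ∀ σ : K ≃ₐ[ℚ] K, PadicInt.toZMod ((ψ σ : ℤ_[p]ˣ) : ℤ_[p]) = ((θ σ : (ZMod p)ˣ) : ZMod p)) :
    (⨅ σ : K ≃ₐ[ℚ] K, eigenspace (baseChangeRep (ZMod p) (classGroupRep ℚ K) σ) ((θ σ : (ZMod p)ˣ) : ZMod p)) = ⊥ :=
  iInf_eigenspace_baseChangeRep_eq_bot_of_forall (classGroupRep ℚ K) θ fun _ hx =>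
    classGroup_eigen_mod_mem_smul hMW hp2 hpK hprim hodd hχω hψχ hB θ hθ hx

open Literature.NumberTheory.LFunctions in
/-- The same from the SECOND tree typing of Mazur–Wiles (`IsDirichletAvatar` interface).
[cite: MazurWiles1984, Thm. 2 (p. 216) — via Solomon1990, §I p. 468; Washington1997, §6.3] -/
theorem iInf_eigenspace_classGroup_modP_eq_bot_of_isDirichletAvatar
    (hMW : MazurWiles1984.thm2_oddChiPart_classGroup_card_eq_pow_val_bernoulli) (hp2 : p ≠ 2)
    (hpK : ¬ p ∣ Module.finrank ℚ K) (ψ : (K ≃ₐ[ℚ] K) →* ℤ_[p]ˣ)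
    {f : ℕ} [NeZero f] (χ : DirichletCharacter ℚ_[p] f) (m : ℕ) (hprim : χ.IsPrimitive)
    (hψχ : IsDirichletAvatar K ψ χ m) (hodd : χ.Odd)
    (hχω : ¬ (f = p ∧ ∀ a : ℤ, ¬ ((p : ℤ) ∣ a) → ‖χ (a : ZMod f) - (a : ℚ_[p])‖ < 1))
    (hB : ‖(generalizedBernoulli 1 χ⁻¹ : ℚ_[p])‖ = 1)
    (θ : (K ≃ₐ[ℚ] K) →* (ZMod p)ˣ)
    (hθ : ∀ σ : K ≃ₐ[ℚ] K, PadicInt.toZMod ((ψ σ : ℤ_[p]ˣ) : ℤ_[p]) = ((θ σ : (ZMod p)ˣ) : ZMod p)) :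
    (⨅ σ : K ≃ₐ[ℚ] K, eigenspace (baseChangeRep (ZMod p) (classGroupRep ℚ K) σ) ((θ σ : (ZMod p)ˣ) : ZMod p)) = ⊥ :=
  iInf_eigenspace_baseChangeRep_eq_bot_of_forall (classGroupRep ℚ K) θ fun _ hx =>
    classGroup_eigen_mod_mem_smul_of_isDirichletAvatar hMW hp2 hpK ψ χ m hprim hψχ hodd hχω hB θ hθ hx

/-- `|Gal(K/ℚ)|` is invertible in `𝔽_p` when `p ∤ [K : ℚ]`. [folklore] -/
theorem isUnit_card_gal_zmod (hpK : ¬ p ∣ Module.finrank ℚ K) :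
    IsUnit (Fintype.card (K ≃ₐ[ℚ] K) : ZMod p) := by
  rw [Fintype.card_eq_nat_card, IsGalois.card_aut_eq_finrank]
  have hp : (p : ℕ).Prime := Fact.out
  rw [ZMod.isUnit_iff_coprime]
  exact (Nat.Prime.coprime_iff_not_dvd hp).mpr hpK |>.symm

/-- **F1ᵈ (LEAD g8 report §4, first named fact) AS A THEOREM modulo Mazur–Wiles: every `θ̄`-equivariant `𝔽_p`-linear map out of
`𝔽_p ⊗_ℤ Cl(K)` is `0`** when `θ̄` is (the reduction of the avatar of) an odd primitive non-Teichmüller `χ` with `‖B_{1,χ⁻¹}‖_p = 1`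
(`p` odd, `K/ℚ` abelian, `p ∤ [K:ℚ]`). [cite: MazurWiles1984, Thm. 2 (p. 216) — via Solomon1990, §I p. 468; Washington1997, §6.3] -/
theorem linearMap_classGroup_modP_eq_zero_of_equivariant
    (hMW : MazurWiles1984.thm2_card_oddChiClassGroup_eq_bernoulli) (hp2 : p ≠ 2)
    (hpK : ¬ p ∣ Module.finrank ℚ K)
    {f : ℕ} [NeZero f] {χ : DirichletCharacter ℚ_[p] f} (hprim : χ.IsPrimitive) (hodd : χ.Odd)
    (hχω : ¬ ∀ a : ℤ, ¬ ((p : ℤ) ∣ a) → ‖χ (a : ZMod f) - (a : ℚ_[p])‖ < 1)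
    {ψ : (K ≃ₐ[ℚ] K) →* ℤ_[p]ˣ}
    (hψχ : ∀ τ : absoluteGaloisGroup ℚ,
      (((ψ (absGaloisQuot ℚ K τ) : ℤ_[p]ˣ) : ℤ_[p]) : ℚ_[p]) =
        χ ((modNCyclotomicCharacter ℚ f τ : (ZMod f)ˣ) : ZMod f))
    (hB : ‖KrizLi2019.bernoulliOnePrim χ⁻¹‖ = 1)
    (θ : (K ≃ₐ[ℚ] K) →* (ZMod p)ˣ)
    (hθ : ∀ σ : K ≃ₐ[ℚ] K, PadicInt.toZMod ((ψ σ : ℤ_[p]ˣ) : ℤ_[p]) = ((θ σ : (ZMod p)ˣ) : ZMod p))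
    {W : Type*} [AddCommGroup W] [Module (ZMod p) W]
    (F : ZMod p ⊗[ℤ] Additive (ClassGroup (𝓞 K)) →ₗ[ZMod p] W)
    (hF : ∀ (σ : K ≃ₐ[ℚ] K) (ξ : ZMod p ⊗[ℤ] Additive (ClassGroup (𝓞 K))),
      F (baseChangeRep (ZMod p) (classGroupRep ℚ K) σ ξ) = ((θ σ : (ZMod p)ˣ) : ZMod p) • F ξ) :
    F = 0 := by
  haveI : Invertible (Fintype.card (K ≃ₐ[ℚ] K) : ZMod p) := (isUnit_card_gal_zmod hpK).invertible
  exact HerbrandEigenspace.eq_zero_of_equivariant_of_iInf_eigenspace_eq_bot _ θ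
    (iInf_eigenspace_classGroup_modP_eq_bot hMW hp2 hpK hprim hodd hχω hψχ hB θ hθ) F hF

end ClassGroup

end Summit.BirchSwinnertonDyer.BirchSwinnertonDyer.Theorems.PrintCFram.HerbrandOddClassGroup

end
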